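import Mathlib
import HarnessLib

/-!
# Format C, L-C3b at every order: zeta tails `Σ_{m≥B₃} m^{−e}` and the Gram ("Hankel") majorant

Route context: Fourier–Galerkin / Schur-complement certificates of Weil positivity on a window ("format C";
cell memo `run/shared/lean/pub/rh-explicit/rh-explicit-weil-10/FORMATC-DESIGN.md` §9.9; supporting
stmt-RiemannHypothesis-0098; seat rh-explicit-weil-10).  The order-`J` structured tail of the coupling columns
(`WeilFormatCColumnKernel.lean`) is a polynomial in `1/m` per block row; summing its square over the tail modes
`m ≥ B₃` against weights `≤ 1/d₀` produces the Gram matrix `Z_{jj'} = Σ_{m≥B₃} m^{−(e_j+e_{j'})}` of inverse powers.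
This file supplies, with NO special functions:

* `one_div_pow_le_telescope`, `telescope_le_one_div_pow` — `1/m^e` against the telescoping differences of
  `1/((e−1)x^{e−1})` (Bernoulli's inequality);
* `summable_one_div_add_pow`, `tsum_one_div_add_pow_le`, `le_tsum_one_div_add_pow` — for `2 ≤ e`, `2 ≤ B₃`:
  `1/((e−1)B₃^{e−1}) ≤ Σ_{k≥0} 1/(B₃+k)^e ≤ 1/((e−1)(B₃−1)^{e−1})`;
* `sum_Ico_sq_sum_div_pow_le_gram` — for every `N`: `Σ_{m∈Ico B₃ N} (Σ_j α_j/m^{e_j})² ≤ Σ_{j,j'} α_jα_{j'} T(e_j+e_{j'})`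
  with `T(e) = Σ_{k≥0} 1/(B₃+k)^e` (the finite Gram is below the infinite one);
* `gram_le_mid_add_gershgorin` — pure algebra: a symmetric array `T` with `|T_{jj'} − Z_{jj'}| ≤ r_{jj'}` satisfies
  `Σ α_jα_{j'}T_{jj'} ≤ Σ α_jα_{j'}Z_{jj'} + Σ_j α_j² Σ_{j'} r_{jj'} λ_{j'}/λ_j` for any positive weights `λ`;
* `sum_Ico_sq_sum_div_pow_le` — the two combined with `Z = (hi+lo)/2`, `r = (hi−lo)/2`: the explicit, `N`-uniform
  majorant used by `WeilFormatCTailEvenJ/OddJ`.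

Elementary; standard axioms; no definitions; no RH claim.
-/

set_option autoImplicit false
-- `Summit.RiemannHypothesis.RiemannHypothesis.…` is the layout-mandated namespace (summit = problem name).
set_option linter.dupNamespace false

noncomputable section

open Finset Filter Topology
open scoped BigOperators

namespace Summit.RiemannHypothesis.RiemannHypothesis.Theorems.WeilFormatC

/-! ## Telescoping bounds for `1/m^e` -/

section Telescope

/-- Upper telescoping: for real `x > 0` and `k : ℕ`: `k/(x+1)^{k+1} ≤ 1/x^k − 1/(x+1)^k` (Bernoulli). -/
theorem div_pow_succ_le_sub {x : ℝ} (hx : 0 < x) (k : ℕ) :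
    (k : ℝ) / (x + 1) ^ (k + 1) ≤ 1 / x ^ k - 1 / (x + 1) ^ k := by
  have hx1 : 0 < x + 1 := by linarith
  have hxk : 0 < x ^ k := pow_pos hx k
  have hx1k : 0 < (x + 1) ^ k := pow_pos hx1 k
  -- Bernoulli: 1 + k/x ≤ (1 + 1/x)^k, multiplied by x^k: x^k + k x^k/x ≤ (x+1)^k
  have hB := one_add_mul_le_pow (a := 1 / x) (by linarith [show (0 : ℝ) < 1 / x from by positivity]) k
  have hpow : x ^ k * (1 + 1 / x) ^ k = (x + 1) ^ k := by
    rw [← mul_pow]; congr 1; field_simp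
  have hB' : x ^ k + k * (x ^ k / x) ≤ (x + 1) ^ k := by
    have := mul_le_mul_of_nonneg_left hB hxk.le
    rw [hpow] at this
    have e : x ^ k * (1 + k * (1 / x)) = x ^ k + k * (x ^ k / x) := by ring
    linarith [e]
  have hB'' : x ^ k * x + k * x ^ k ≤ (x + 1) ^ k * x := by
    have := mul_le_mul_of_nonneg_right hB' hx.le
    have e : (x ^ k + k * (x ^ k / x)) * x = x ^ k * x + k * x ^ k := by field_simp
    linarith [e]
  -- the difference is a nonnegative fraction
  rw [← sub_nonneg]
  have e : 1 / x ^ k - 1 / (x + 1) ^ k - k / (x + 1) ^ (k + 1)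
      = ((x + 1) ^ k * (x + 1) - x ^ k * (x + 1) - k * x ^ k) / (x ^ k * (x + 1) ^ (k + 1)) := by
    field_simp
    ring
  rw [e]
  apply div_nonneg _ (by positivity)
  nlinarith [hB'', hx1k, hxk]

/-- **Upper telescoping term**: for `2 ≤ e` and real `m` with `1 < m`:
`1/m^e ≤ (1/(m−1)^{e−1} − 1/m^{e−1})/(e−1)`. -/
theorem one_div_pow_le_telescope {e : ℕ} (he : 2 ≤ e) {m : ℝ} (hm : 1 < m) :
    1 / m ^ e ≤ (1 / (m - 1) ^ (e - 1) - 1 / m ^ (e - 1)) / (e - 1) := by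
  obtain ⟨k, rfl⟩ : ∃ k, e = k + 1 := ⟨e - 1, by omega⟩
  have hk : 1 ≤ k := by omega
  have hk0 : (0 : ℝ) < k := by exact_mod_cast hk
  simp only [Nat.add_sub_cancel]
  have h := div_pow_succ_le_sub (x := m - 1) (by linarith) k
  simp only [sub_add_cancel] at h
  push_cast
  rw [add_sub_cancel_right, le_div_iff₀ hk0]
  calc 1 / m ^ (k + 1) * k = (k : ℝ) / m ^ (k + 1) := by ring
    _ ≤ _ := h

/-- **Lower telescoping term**: for `2 ≤ e` and real `m` with `0 < m`:
`(1/m^{e−1} − 1/(m+1)^{e−1})/(e−1) ≤ 1/m^e`. -/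
theorem telescope_le_one_div_pow {e : ℕ} (he : 2 ≤ e) {m : ℝ} (hm : 0 < m) :
    (1 / m ^ (e - 1) - 1 / (m + 1) ^ (e - 1)) / (e - 1) ≤ 1 / m ^ e := by
  obtain ⟨k, rfl⟩ : ∃ k, e = k + 1 := ⟨e - 1, by omega⟩
  have hk : 1 ≤ k := by omega
  have hk0 : (0 : ℝ) < k := by exact_mod_cast hk
  simp only [Nat.add_sub_cancel]
  push_cast
  rw [add_sub_cancel_right, div_le_iff₀ hk0]
  have hm1 : 0 < m + 1 := by linarith
  -- Bernoulli with a = -1/(m+1): (1 - 1/(m+1))^k ≥ 1 - k/(m+1), i.e. (m/(m+1))^k ≥ 1 - k/(m+1)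
  have hB := one_add_mul_le_pow (a := -(1 / (m + 1))) (by
    have : 1 / (m + 1) ≤ 1 := by rw [div_le_one hm1]; linarith
    linarith) k
  have hratio : (1 + -(1 / (m + 1))) = m / (m + 1) := by field_simp; ring
  rw [hratio, div_pow] at hB
  -- hB : 1 + k * -(1/(m+1)) ≤ m^k/(m+1)^k
  have hmk : 0 < m ^ k := pow_pos hm k
  have hm1k : 0 < (m + 1) ^ k := pow_pos hm1 k
  -- target: 1/m^k - 1/(m+1)^k ≤ 1/m^(k+1) * k
  rw [div_sub_div _ _ hmk.ne' hm1k.ne', div_le_iff₀ (by positivity), one_mul, pow_succ]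
  -- (m+1)^k - m^k ≤ k/(m^k m) * (m^k (m+1)^k) = k (m+1)^k / m
  have e1 : 1 / (m ^ k * m) * k * (m ^ k * (m + 1) ^ k) = k * (m + 1) ^ k / m := by
    field_simp
  rw [mul_one, e1, le_div_iff₀ hm]
  -- ((m+1)^k - m^k) m ≤ k (m+1)^k ; from hB: (m+1)^k (1 - k/(m+1)) ≤ m^k
  have h2 : (m + 1) ^ k * (1 + k * -(1 / (m + 1))) ≤ m ^ k := by
    have := mul_le_mul_of_nonneg_left hB hm1k.le
    rwa [mul_div_assoc', mul_comm ((m + 1) ^ k) (m ^ k), mul_div_assoc, div_self hm1k.ne', mul_one] at this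
  have e3 : (m + 1) ^ k * (1 + k * -(1 / (m + 1))) = (m + 1) ^ k - k * ((m + 1) ^ k / (m + 1)) := by ring
  have h4 : (m + 1) ^ k - m ^ k ≤ k * ((m + 1) ^ k / (m + 1)) := by linarith [h2, e3]
  have h5 : ((m + 1) ^ k - m ^ k) * m ≤ k * ((m + 1) ^ k / (m + 1)) * m := mul_le_mul_of_nonneg_right h4 hm.le
  have h6 : (m + 1) ^ k / (m + 1) * m ≤ (m + 1) ^ k := by
    rw [div_mul_eq_mul_div, div_le_iff₀ hm1]
    nlinarith [hm1k]
  have h7 : k * ((m + 1) ^ k / (m + 1)) * m ≤ k * (m + 1) ^ k := by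
    rw [mul_assoc]
    exact mul_le_mul_of_nonneg_left h6 hk0.le
  linarith [h5, h7]

end Telescope

/-! ## The zeta tails `T(e) = Σ_{k≥0} 1/(B₃+k)^e` -/

section ZetaTail

/-- Summability of the shifted inverse powers for `2 ≤ e`. -/
theorem summable_one_div_add_pow {e : ℕ} (he : 2 ≤ e) (B₃ : ℕ) :
    Summable (fun k : ℕ ↦ 1 / ((B₃ : ℝ) + k) ^ e) := by
  have h := (Real.summable_one_div_nat_pow.mpr (by omega : 1 < e))
  have h2 := (summable_nat_add_iff B₃).mpr h
  refine h2.congr fun k ↦ ?_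
  push_cast
  ring_nf

/-- **Upper bound**: `Σ_{k≥0} 1/(B₃+k)^e ≤ 1/((e−1)(B₃−1)^{e−1})` for `2 ≤ e`, `2 ≤ B₃`. -/
theorem tsum_one_div_add_pow_le {e : ℕ} (he : 2 ≤ e) {B₃ : ℕ} (hB₃ : 2 ≤ B₃) :
    ∑' k : ℕ, 1 / ((B₃ : ℝ) + k) ^ e ≤ 1 / ((e - 1 : ℝ) * (((B₃ - 1 : ℕ) : ℝ)) ^ (e - 1)) := by
  have hB1 : (1 : ℝ) < B₃ := by exact_mod_cast hB₃
  have he1 : (0 : ℝ) < e - 1 := by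
    have : (2 : ℝ) ≤ e := by exact_mod_cast he
    linarith
  set g : ℕ → ℝ := fun k ↦ 1 / (((B₃ : ℝ) + k - 1) ^ (e - 1)) / (e - 1) with hg
  refine Real.tsum_le_of_sum_range_le (f := fun k : ℕ ↦ 1 / ((B₃ : ℝ) + k) ^ e) (fun k ↦ by positivity) fun n ↦ ?_
  -- termwise: f k ≤ g k - g (k+1); telescope
  have hterm : ∀ k : ℕ, 1 / ((B₃ : ℝ) + k) ^ e ≤ g k - g (k + 1) := by
    intro k
    have hk0 : (0 : ℝ) ≤ k := Nat.cast_nonneg k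
    have h := one_div_pow_le_telescope he (m := (B₃ : ℝ) + k) (by linarith)
    simp only [hg]
    push_cast
    rw [show (B₃ : ℝ) + (k + 1) - 1 = B₃ + k by ring]
    rw [sub_div] at h
    exact h
  calc ∑ k ∈ Finset.range n, 1 / ((B₃ : ℝ) + k) ^ e ≤ ∑ k ∈ Finset.range n, (g k - g (k + 1)) :=
        Finset.sum_le_sum fun k _ ↦ hterm k
    _ = g 0 - g n := Finset.sum_range_sub' g n
    _ ≤ g 0 := by
        have hpos : (0 : ℝ) ≤ (B₃ : ℝ) + n - 1 := by linarith [hB1, (Nat.cast_nonneg n : (0 : ℝ) ≤ n)]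
        have : 0 ≤ g n := by
          simp only [hg]
          exact div_nonneg (div_nonneg zero_le_one (pow_nonneg hpos _)) he1.le
        linarith
    _ = 1 / ((e - 1 : ℝ) * (((B₃ - 1 : ℕ) : ℝ)) ^ (e - 1)) := by
        simp only [hg, Nat.cast_zero, add_zero]
        rw [Nat.cast_sub (by omega : 1 ≤ B₃), Nat.cast_one, div_div, mul_comm]

/-- **Lower bound**: `1/((e−1)B₃^{e−1}) ≤ Σ_{k≥0} 1/(B₃+k)^e` for `2 ≤ e`, `1 ≤ B₃`. -/
theorem le_tsum_one_div_add_pow {e : ℕ} (he : 2 ≤ e) {B₃ : ℕ} (hB₃ : 1 ≤ B₃) :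
    1 / ((e - 1 : ℝ) * (B₃ : ℝ) ^ (e - 1)) ≤ ∑' k : ℕ, 1 / ((B₃ : ℝ) + k) ^ e := by
  have hB0 : (0 : ℝ) < B₃ := by exact_mod_cast hB₃
  have he1 : (0 : ℝ) < e - 1 := by
    have : (2 : ℝ) ≤ e := by exact_mod_cast he
    linarith
  have hsum := summable_one_div_add_pow he B₃
  set g : ℕ → ℝ := fun k ↦ 1 / (((B₃ : ℝ) + k) ^ (e - 1)) / (e - 1) with hg
  -- partial sums ≥ g 0 - g n
  have hpartial : ∀ n, g 0 - g n ≤ ∑ k ∈ Finset.range n, 1 / ((B₃ : ℝ) + k) ^ e := by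
    intro n
    have hterm : ∀ k : ℕ, g k - g (k + 1) ≤ 1 / ((B₃ : ℝ) + k) ^ e := by
      intro k
      have h := telescope_le_one_div_pow he (m := (B₃ : ℝ) + k) (by positivity)
      simp only [hg]
      push_cast
      rw [show (B₃ : ℝ) + (k + 1) = B₃ + k + 1 by ring]
      rw [sub_div] at h
      exact h
    calc g 0 - g n = ∑ k ∈ Finset.range n, (g k - g (k + 1)) := (Finset.sum_range_sub' g n).symm
      _ ≤ _ := Finset.sum_le_sum fun k _ ↦ hterm k
  -- g n → 0
  have hg_tendsto : Tendsto (fun n : ℕ ↦ g 0 - g n) atTop (𝓝 (g 0 - 0)) := by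
    refine tendsto_const_nhds.sub ?_
    simp only [hg]
    have h1 : Tendsto (fun n : ℕ ↦ ((B₃ : ℝ) + n) ^ (e - 1)) atTop atTop := by
      refine tendsto_pow_atTop (by omega) |>.comp ?_
      exact tendsto_atTop_add_const_left _ _ tendsto_natCast_atTop_atTop
    have h2 : Tendsto (fun n : ℕ ↦ 1 / ((B₃ : ℝ) + n) ^ (e - 1)) atTop (𝓝 0) := by
      have := h1.inv_tendsto_atTop
      refine this.congr fun n ↦ ?_
      simp only [Pi.inv_apply, one_div]
    have h3 := h2.div_const (e - 1 : ℝ)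
    simpa using h3
  have hlim := hsum.tendsto_sum_tsum_nat
  have := le_of_tendsto_of_tendsto' hg_tendsto hlim hpartial
  simp only [hg, Nat.cast_zero, add_zero, sub_zero] at this
  rw [div_div, mul_comm] at this
  exact this

end ZetaTail

/-! ## The Gram majorant -/

section Gram

/-- **Finite Gram below the infinite one.**  For `2 ≤ B₃`, exponents `e_j ≥ 1` and every `N`, `α`:
`Σ_{m∈Ico B₃ N} (Σ_j α_j/m^{e_j})² ≤ Σ_j Σ_{j'} α_j α_{j'} · Σ_{k≥0} 1/(B₃+k)^{e_j+e_{j'}}`. -/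
theorem sum_Ico_sq_sum_div_pow_le_gram {D : ℕ} (e : Fin D → ℕ) (he : ∀ j, 1 ≤ e j) {B₃ : ℕ} (hB₃ : 1 ≤ B₃)
    (N : ℕ) (α : Fin D → ℝ) :
    ∑ m ∈ Finset.Ico B₃ N, (∑ j, α j / (m : ℝ) ^ e j) ^ 2
      ≤ ∑ j, ∑ j', α j * α j' * ∑' k : ℕ, 1 / ((B₃ : ℝ) + k) ^ (e j + e j') := by
  -- the summand as a function of k = m - B₃
  set f : ℕ → ℝ := fun k ↦ (∑ j, α j / ((B₃ : ℝ) + k) ^ e j) ^ 2 with hf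
  have hf0 : ∀ k, 0 ≤ f k := fun k ↦ sq_nonneg _
  -- expand the square termwise
  have hexp : ∀ k : ℕ, f k = ∑ j, ∑ j', α j * α j' * (1 / ((B₃ : ℝ) + k) ^ (e j + e j')) := by
    intro k
    simp only [hf, sq, Finset.sum_mul_sum]
    refine Finset.sum_congr rfl fun j _ ↦ Finset.sum_congr rfl fun j' _ ↦ ?_
    rw [pow_add]
    field_simp
  have hsumm : ∀ j j' : Fin D, Summable (fun k : ℕ ↦ α j * α j' * (1 / ((B₃ : ℝ) + k) ^ (e j + e j'))) :=
    fun j j' ↦ (summable_one_div_add_pow (by have := he j; have := he j'; omega) B₃).mul_left _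
  have hfs : Summable f := by
    have : Summable (fun k : ℕ ↦ ∑ j, ∑ j', α j * α j' * (1 / ((B₃ : ℝ) + k) ^ (e j + e j'))) :=
      summable_sum fun j _ ↦ summable_sum fun j' _ ↦ hsumm j j'
    exact this.congr fun k ↦ (hexp k).symm
  -- Ico sum = range sum of f
  have hIco : ∑ m ∈ Finset.Ico B₃ N, (∑ j, α j / (m : ℝ) ^ e j) ^ 2 = ∑ k ∈ Finset.range (N - B₃), f k := by
    rw [Finset.sum_Ico_eq_sum_range]
    refine Finset.sum_congr rfl fun k _ ↦ ?_
    simp only [hf]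
    push_cast
    rfl
  rw [hIco]
  calc ∑ k ∈ Finset.range (N - B₃), f k ≤ ∑' k, f k := hfs.sum_le_tsum _ fun k _ ↦ hf0 k
    _ = ∑' k : ℕ, ∑ j, ∑ j', α j * α j' * (1 / ((B₃ : ℝ) + k) ^ (e j + e j')) := tsum_congr hexp
    _ = ∑ j, ∑' k : ℕ, ∑ j', α j * α j' * (1 / ((B₃ : ℝ) + k) ^ (e j + e j')) :=
        Summable.tsum_finsetSum fun j _ ↦ summable_sum fun j' _ ↦ hsumm j j'
    _ = ∑ j, ∑ j', ∑' k : ℕ, α j * α j' * (1 / ((B₃ : ℝ) + k) ^ (e j + e j')) :=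
        Finset.sum_congr rfl fun j _ ↦ Summable.tsum_finsetSum fun j' _ ↦ hsumm j j'
    _ = ∑ j, ∑ j', α j * α j' * ∑' k : ℕ, 1 / ((B₃ : ℝ) + k) ^ (e j + e j') :=
        Finset.sum_congr rfl fun j _ ↦ Finset.sum_congr rfl fun j' _ ↦ tsum_mul_left

/-- **Weighted Gershgorin on the radii** (pure algebra): if `|T j j' − Z j j'| ≤ r j j'` with `r` symmetric and
`λ > 0`, then `Σ α_jα_{j'} T_{jj'} ≤ Σ α_jα_{j'} Z_{jj'} + Σ_j α_j² Σ_{j'} r_{jj'} λ_{j'}/λ_j`. -/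
theorem gram_le_mid_add_gershgorin {D : ℕ} (T Z r : Fin D → Fin D → ℝ) (lam α : Fin D → ℝ)
    (hlam : ∀ j, 0 < lam j) (hr : ∀ j j', |T j j' - Z j j'| ≤ r j j') (hsymm : ∀ j j', r j j' = r j' j) :
    ∑ j, ∑ j', α j * α j' * T j j'
      ≤ ∑ j, ∑ j', α j * α j' * Z j j' + ∑ j, α j ^ 2 * ∑ j', r j j' * lam j' / lam j := by
  -- termwise AM-GM: α α' (T - Z) ≤ |α||α'| r ≤ r (λ'/λ α² + λ/λ' α'²)/2
  have hterm : ∀ j j', α j * α j' * T j j'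
      ≤ α j * α j' * Z j j' + (r j j' * lam j' / lam j * α j ^ 2 / 2 + r j j' * lam j / lam j' * α j' ^ 2 / 2) := by
    intro j j'
    have h1 : α j * α j' * (T j j' - Z j j') ≤ |α j| * |α j'| * r j j' := by
      calc α j * α j' * (T j j' - Z j j') ≤ |α j * α j' * (T j j' - Z j j')| := le_abs_self _
        _ = |α j| * |α j'| * |T j j' - Z j j'| := by rw [abs_mul, abs_mul]
        _ ≤ |α j| * |α j'| * r j j' := mul_le_mul_of_nonneg_left (hr j j') (by positivity)
    have hr0 : 0 ≤ r j j' := (abs_nonneg _).trans (hr j j')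
    have hl := hlam j; have hl' := hlam j'
    -- weighted AM-GM: 2|α||α'| ≤ (λ'/λ) α² + (λ/λ') α'²
    have h2 : 2 * (|α j| * |α j'|) ≤ lam j' / lam j * |α j| ^ 2 + lam j / lam j' * |α j'| ^ 2 := by
      rw [← sub_nonneg]
      have e : lam j' / lam j * |α j| ^ 2 + lam j / lam j' * |α j'| ^ 2 - 2 * (|α j| * |α j'|)
          = (lam j' * |α j| - lam j * |α j'|) ^ 2 / (lam j * lam j') := by
        field_simp
        ring
      rw [e]; positivity
    rw [sq_abs, sq_abs] at h2
    have h3 := mul_le_mul_of_nonneg_left h2 hr0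
    have e4 : r j j' * (lam j' / lam j * α j ^ 2 + lam j / lam j' * α j' ^ 2)
        = 2 * (r j j' * lam j' / lam j * α j ^ 2 / 2 + r j j' * lam j / lam j' * α j' ^ 2 / 2) := by ring
    have e5 : r j j' * (2 * (|α j| * |α j'|)) = 2 * (|α j| * |α j'| * r j j') := by ring
    rw [e4, e5] at h3
    rw [mul_sub] at h1
    linarith [h1, h3]
  have hswap : ∑ j, ∑ j', r j j' * lam j / lam j' * α j' ^ 2 / 2 = ∑ j, ∑ j', r j j' * lam j' / lam j * α j ^ 2 / 2 := by
    rw [Finset.sum_comm]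
    refine Finset.sum_congr rfl fun j _ ↦ Finset.sum_congr rfl fun j' _ ↦ ?_
    rw [hsymm j' j]
  calc ∑ j, ∑ j', α j * α j' * T j j'
      ≤ ∑ j, ∑ j', (α j * α j' * Z j j' + (r j j' * lam j' / lam j * α j ^ 2 / 2 + r j j' * lam j / lam j' * α j' ^ 2 / 2)) :=
        Finset.sum_le_sum fun j _ ↦ Finset.sum_le_sum fun j' _ ↦ hterm j j'
    _ = ∑ j, ∑ j', α j * α j' * Z j j'
        + (∑ j, ∑ j', r j j' * lam j' / lam j * α j ^ 2 / 2 + ∑ j, ∑ j', r j j' * lam j / lam j' * α j' ^ 2 / 2) := by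
        simp only [Finset.sum_add_distrib]
    _ = ∑ j, ∑ j', α j * α j' * Z j j' + ∑ j, α j ^ 2 * ∑ j', r j j' * lam j' / lam j := by
        rw [hswap]
        congr 1
        rw [← Finset.sum_add_distrib]
        refine Finset.sum_congr rfl fun j _ ↦ ?_
        rw [← Finset.sum_add_distrib, Finset.mul_sum]
        refine Finset.sum_congr rfl fun j' _ ↦ by ring

/-- **The explicit, `N`-uniform Gram majorant.**  For `2 ≤ B₃`, exponents `e_j ≥ 1`, positive weights `λ_j`, every
`N` and `α`, with `hi(e) = 1/((e−1)(B₃−1)^{e−1})`, `lo(e) = 1/((e−1)B₃^{e−1})`: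
`Σ_{m∈Ico B₃ N} (Σ_j α_j/m^{e_j})² ≤ Σ_{j,j'} α_jα_{j'}(hi+lo)(e_j+e_{j'})/2 + Σ_j α_j² Σ_{j'} ((hi−lo)(e_j+e_{j'})/2)·λ_{j'}/λ_j`. -/
theorem sum_Ico_sq_sum_div_pow_le {D : ℕ} (e : Fin D → ℕ) (he : ∀ j, 1 ≤ e j) {B₃ : ℕ} (hB₃ : 2 ≤ B₃)
    (lam : Fin D → ℝ) (hlam : ∀ j, 0 < lam j) (N : ℕ) (α : Fin D → ℝ) :
    ∑ m ∈ Finset.Ico B₃ N, (∑ j, α j / (m : ℝ) ^ e j) ^ 2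
      ≤ ∑ j, ∑ j', α j * α j' *
            ((1 / ((e j + e j' - 1 : ℕ) * (((B₃ - 1 : ℕ) : ℝ)) ^ (e j + e j' - 1))
              + 1 / ((e j + e j' - 1 : ℕ) * (B₃ : ℝ) ^ (e j + e j' - 1))) / 2)
        + ∑ j, α j ^ 2 * ∑ j',
            ((1 / ((e j + e j' - 1 : ℕ) * (((B₃ - 1 : ℕ) : ℝ)) ^ (e j + e j' - 1))
              - 1 / ((e j + e j' - 1 : ℕ) * (B₃ : ℝ) ^ (e j + e j' - 1))) / 2) * lam j' / lam j := by
  have h1 := sum_Ico_sq_sum_div_pow_le_gram e he (by omega : 1 ≤ B₃) N α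
  refine h1.trans ?_
  refine gram_le_mid_add_gershgorin (fun j j' ↦ ∑' k : ℕ, 1 / ((B₃ : ℝ) + k) ^ (e j + e j'))
    _ (fun j j' ↦ ((1 / ((e j + e j' - 1 : ℕ) * (((B₃ - 1 : ℕ) : ℝ)) ^ (e j + e j' - 1))
              - 1 / ((e j + e j' - 1 : ℕ) * (B₃ : ℝ) ^ (e j + e j' - 1))) / 2)) lam α hlam ?_ ?_
  · intro j j'
    have hejj : 2 ≤ e j + e j' := by have := he j; have := he j'; omega
    have hup := tsum_one_div_add_pow_le hejj hB₃
    have hlo := le_tsum_one_div_add_pow hejj (by omega : 1 ≤ B₃)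
    have hcast : ((e j + e j' : ℕ) : ℝ) - 1 = ((e j + e j' - 1 : ℕ) : ℝ) := by
      rw [Nat.cast_sub (by omega), Nat.cast_one]
    push_cast at hup hlo hcast ⊢
    rw [hcast] at hup hlo
    rw [abs_le]
    constructor <;> linarith
  · intro j j'
    simp only [add_comm (e j) (e j')]

end Gram

end Summit.RiemannHypothesis.RiemannHypothesis.Theorems.WeilFormatC

end
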